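import Mathlib
import HarnessLib

/-!
# Volumes of solids of revolution: slice, disk, washer and shell methods

**Statement.** The boxed volume formulas of Marsden–Weinstein, *Calculus II*, Sect. 9.1–9.2, stated and proved as
theorems about Lebesgue measure (`volume`) on `ℝ × (ℝ × ℝ)` (axis coordinate first, then the plane of rotation):

* the slice method (Cavalieri's principle, Sect. 9.1 p. 422): if a measurable solid `S` lies between the planes
  `x = a` and `x = b` and its slice at height `x` has area `A x`, then `vol S = ∫ x in a..b, A x`
  (`volume_eq_integral_sliceArea`);
* the disk method (Sect. 9.1 p. 423): revolving the region under the graph of `f` on `[a, b]` about the `x` axis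
  gives the solid `{(x, y, z) | a ≤ x ≤ b, y² + z² ≤ f x²}` of volume `π ∫ x in a..b, f x ^ 2`
  (`solidOfRevolution`, `volume_solidOfRevolution`);
* the washer method (Sect. 9.1 p. 424): for `0 ≤ f ≤ g` on `[a, b]` the solid `{f x² ≤ y² + z² ≤ g x²}` has volume
  `π ∫ x in a..b, (g x ^ 2 - f x ^ 2)` (`washerSolid`, `volume_washerSolid`);
* the shell method (Sect. 9.2 p. 429): revolving the region between the graphs of `f ≤ g` on `[a, b]`, `0 ≤ a`,
  about the vertical axis gives `{(w, y) | a ≤ |w| ≤ b, f |w| ≤ y ≤ g |w|}` (`w ∈ ℝ × ℝ`, `|w| = √(w₁² + w₂²)`) of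
  volume `2 π ∫ x in a..b, x * (g x - f x)`, in particular `2 π ∫ x in a..b, x * f x` for the region under a
  non-negative graph (`shellSolidBetween`, `volume_shellSolidBetween`, `shellSolid`, `volume_shellSolid`);
* the textbook checks: `x²` on `[0, 1]` about the `x` axis has volume `π / 5` (Sect. 9.1 Example 5), about the
  `y` axis `π / 2` (Sect. 9.2 Example 1), and the ball of radius `R` (disk method with `f x = √(R² - x²)`) has
  volume `4 π R³ / 3` (Sect. 9.2 p. 430).

The disc-area input `vol {y² + z² ≤ ρ} = π ρ` is transported from Mathlib's `Complex.volume_closedBall` along the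
measure-preserving `Complex.measurableEquivRealProd`; the shell method is Mathlib's polar-coordinate formula
`lintegral_comp_polarCoord_symm` applied to a radial indicator.  The solids are CLOSED (boundary included), which
does not change any volume.

**Why here.** Client cells meet "volume of an axially symmetric body" constantly (tanks, nozzles, lathe profiles,
bodies of revolution in drag estimates); a certified one-dimensional quadrature of `π f²` or `2 π x f` is only a
certified VOLUME once the reduction from the three-dimensional Lebesgue measure to that integral is itself a
theorem.  Mathlib has the ingredients (product measures, ball volumes, polar coordinates) but not the calculus-text
statements; the tree had Cavalieri only for the right circular cone (`Literature.MeasureTheory.Hausdorff.ConeVolume`,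
plane modelled as `Fin 2 → ℝ`).

Honest framing: this is infrastructure for shared numerical engines serving client cells; rigour lives in the
verifiers (the kernel-checked certificate that consumes the one-dimensional integral); every published number
belongs to a client cell's ledger, not to the engines group.  Nothing here is claimed as new mathematics.

Topic `Literature/MeasureTheory/Integral`; namespace `Literature.MeasureTheory.Integral`.

References: [MarsdenWeinstein1985] J. Marsden, A. Weinstein, *Calculus II*, Springer 1985, Sect. 9.1 (pp. 421–427)
and Sect. 9.2 (pp. 428–432).
-/

namespace Literature.MeasureTheory.Integral

open _root_.MeasureTheory _root_.MeasureTheory.Measure Set Real Filter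
open scoped ENNReal Topology

noncomputable section

/-! ### Disc areas in `ℝ × ℝ` (parametrised by the squared radius) -/

/-- The closed disc `{(y, z) | y² + z² ≤ ρ}` of squared radius `ρ ≥ 0` has area `π ρ` (Lebesgue measure on `ℝ × ℝ`,
transported from `Complex.volume_closedBall`). [cite: MarsdenWeinstein1985, Sect. 9.1 p. 423] -/
theorem volume_closedDisc {ρ : ℝ} (hρ : 0 ≤ ρ) :
    volume {q : ℝ × ℝ | q.1 ^ 2 + q.2 ^ 2 ≤ ρ} = ENNReal.ofReal (π * ρ) := by
  have hD : MeasurableSet {q : ℝ × ℝ | q.1 ^ 2 + q.2 ^ 2 ≤ ρ} :=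
    measurableSet_le (by fun_prop) measurable_const
  have hpre : Complex.measurableEquivRealProd ⁻¹' {q : ℝ × ℝ | q.1 ^ 2 + q.2 ^ 2 ≤ ρ} =
      Metric.closedBall (0 : ℂ) (√ρ) := by
    ext z
    simp only [mem_preimage, Complex.measurableEquivRealProd_apply, mem_setOf_eq, Metric.mem_closedBall,
      dist_zero_right]
    rw [Real.le_sqrt (norm_nonneg z) hρ, Complex.sq_norm, Complex.normSq_apply]
    constructor <;> intro h <;> nlinarith [h]
  rw [← Complex.volume_preserving_equiv_real_prod.measure_preimage hD.nullMeasurableSet, hpre,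
    Complex.volume_closedBall, ← ENNReal.ofReal_pow (sqrt_nonneg _), sq_sqrt hρ, ENNReal.ofReal_mul pi_pos.le,
    ← NNReal.coe_real_pi, ENNReal.ofReal_coe_nnreal, mul_comm]

/-- The open disc `{(y, z) | y² + z² < ρ}` of squared radius `ρ ≥ 0` has area `π ρ`.
[cite: MarsdenWeinstein1985, Sect. 9.1 p. 424] -/
theorem volume_openDisc {ρ : ℝ} (hρ : 0 ≤ ρ) :
    volume {q : ℝ × ℝ | q.1 ^ 2 + q.2 ^ 2 < ρ} = ENNReal.ofReal (π * ρ) := by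
  have hD : MeasurableSet {q : ℝ × ℝ | q.1 ^ 2 + q.2 ^ 2 < ρ} :=
    measurableSet_lt (by fun_prop) measurable_const
  have hpre : Complex.measurableEquivRealProd ⁻¹' {q : ℝ × ℝ | q.1 ^ 2 + q.2 ^ 2 < ρ} =
      Metric.ball (0 : ℂ) (√ρ) := by
    ext z
    simp only [mem_preimage, Complex.measurableEquivRealProd_apply, mem_setOf_eq, Metric.mem_ball,
      dist_zero_right]
    rw [Real.lt_sqrt (norm_nonneg z), Complex.sq_norm, Complex.normSq_apply]
    constructor <;> intro h <;> nlinarith [h]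
  rw [← Complex.volume_preserving_equiv_real_prod.measure_preimage hD.nullMeasurableSet, hpre,
    Complex.volume_ball, ← ENNReal.ofReal_pow (sqrt_nonneg _), sq_sqrt hρ, ENNReal.ofReal_mul pi_pos.le,
    ← NNReal.coe_real_pi, ENNReal.ofReal_coe_nnreal, mul_comm]

/-! ### The slice method (Cavalieri's principle) -/

/-- **Slice method** (Marsden–Weinstein Sect. 9.1, box p. 422).  Let `S ⊆ ℝ × (ℝ × ℝ)` be a measurable solid lying
between the planes `x = a` and `x = b` (`a ≤ b`) whose slice `{q | (x, q) ∈ S}` has (finite) area `A x` for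
`x ∈ [a, b]`, with `A` integrable on `[a, b]`.  Then `vol S = ∫ x in a..b, A x`.
[cite: MarsdenWeinstein1985, Sect. 9.1 p. 422] -/
theorem volume_eq_integral_sliceArea {S : Set (ℝ × (ℝ × ℝ))} (hS : MeasurableSet S) {a b : ℝ} (hab : a ≤ b)
    (hsub : ∀ p ∈ S, p.1 ∈ Icc a b) {A : ℝ → ℝ}
    (hA : ∀ x ∈ Icc a b, volume (Prod.mk x ⁻¹' S) = ENNReal.ofReal (A x))
    (hA0 : ∀ x ∈ Icc a b, 0 ≤ A x) (hAi : IntervalIntegrable A volume a b) :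
    volume S = ENNReal.ofReal (∫ x in a..b, A x) := by
  rw [Measure.volume_eq_prod, Measure.prod_apply hS]
  have hslice : ∀ x, volume (Prod.mk x ⁻¹' S) = (Icc a b).indicator (fun x => ENNReal.ofReal (A x)) x := by
    intro x
    by_cases hx : x ∈ Icc a b
    · rw [indicator_of_mem hx, hA x hx]
    · rw [indicator_of_notMem hx]
      have : Prod.mk x ⁻¹' S = ∅ := eq_empty_of_forall_notMem fun q hq => hx (hsub _ hq)
      rw [this, measure_empty]
  simp_rw [hslice]
  have hAi' : IntegrableOn A (Icc a b) := (intervalIntegrable_iff_integrableOn_Icc_of_le hab).mp hAi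
  have hnn : 0 ≤ᵐ[volume.restrict (Icc a b)] A :=
    (ae_restrict_iff' measurableSet_Icc).mpr (Eventually.of_forall hA0)
  rw [lintegral_indicator measurableSet_Icc, ← ofReal_integral_eq_lintegral_ofReal hAi' hnn,
    intervalIntegral.integral_of_le hab, integral_Icc_eq_integral_Ioc]

/-! ### The disk method -/

/-- The solid of revolution obtained by revolving the region under the graph of `f` on `[a, b]` about the `x` axis:
`{(x, y, z) | a ≤ x ≤ b, y² + z² ≤ (f x)²}` (closed; for `f ≥ 0` this is exactly Marsden–Weinstein's solid `S`).
[cite: MarsdenWeinstein1985, Sect. 9.1 p. 423] -/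
def solidOfRevolution (f : ℝ → ℝ) (a b : ℝ) : Set (ℝ × (ℝ × ℝ)) :=
  {p | p.1 ∈ Icc a b ∧ p.2.1 ^ 2 + p.2.2 ^ 2 ≤ f p.1 ^ 2}

/-- The solid of revolution of a measurable profile is a measurable set. [cite: MarsdenWeinstein1985, Sect. 9.1 p. 423] -/
theorem measurableSet_solidOfRevolution {f : ℝ → ℝ} (hf : Measurable f) (a b : ℝ) :
    MeasurableSet (solidOfRevolution f a b) :=
  (measurableSet_Icc.preimage measurable_fst).inter
    (measurableSet_le (by fun_prop) ((hf.comp measurable_fst).pow_const 2))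

/-- The slice of the solid of revolution at height `x ∈ [a, b]` is the disc of radius `|f x|`, of area `π (f x)²`.
[cite: MarsdenWeinstein1985, Sect. 9.1 p. 423] -/
theorem volume_slice_solidOfRevolution (f : ℝ → ℝ) {a b x : ℝ} (hx : x ∈ Icc a b) :
    volume (Prod.mk x ⁻¹' solidOfRevolution f a b) = ENNReal.ofReal (π * f x ^ 2) := by
  have : Prod.mk x ⁻¹' solidOfRevolution f a b = {q : ℝ × ℝ | q.1 ^ 2 + q.2 ^ 2 ≤ f x ^ 2} := by
    ext q
    simp [solidOfRevolution, mem_Icc.mp hx]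
  rw [this, volume_closedDisc (sq_nonneg _)]

/-- **Disk method** (Marsden–Weinstein Sect. 9.1, box p. 423): the volume of the solid of revolution obtained by
revolving the region under the graph of `f` on `[a, b]` about the `x` axis is `π ∫ x in a..b, (f x)²`
(for measurable `f` with `f²` integrable on `[a, b]`; no sign condition is needed since the slice at `x` is the disc
of radius `|f x|`). [cite: MarsdenWeinstein1985, Sect. 9.1 p. 423] -/
theorem volume_solidOfRevolution {f : ℝ → ℝ} (hf : Measurable f) {a b : ℝ} (hab : a ≤ b)
    (hfi : IntervalIntegrable (fun x => f x ^ 2) volume a b) :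
    volume (solidOfRevolution f a b) = ENNReal.ofReal (π * ∫ x in a..b, f x ^ 2) := by
  rw [← intervalIntegral.integral_const_mul]
  exact volume_eq_integral_sliceArea (measurableSet_solidOfRevolution hf a b) hab (fun p hp => hp.1)
    (fun x hx => volume_slice_solidOfRevolution f hx) (fun x _ => by positivity) (hfi.const_mul π)

/-- Disk method for a continuous profile. [cite: MarsdenWeinstein1985, Sect. 9.1 p. 423] -/
theorem volume_solidOfRevolution_of_continuous {f : ℝ → ℝ} (hf : Continuous f) {a b : ℝ} (hab : a ≤ b) :
    volume (solidOfRevolution f a b) = ENNReal.ofReal (π * ∫ x in a..b, f x ^ 2) :=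
  volume_solidOfRevolution hf.measurable hab ((hf.pow 2).intervalIntegrable a b)

/-- Marsden–Weinstein Sect. 9.1 Example 5: revolving the region under `x²` on `[0, 1]` about the `x` axis gives a
solid of volume `π ∫₀¹ x⁴ dx = π / 5`. [cite: MarsdenWeinstein1985, Sect. 9.1 Example 5] -/
theorem volume_solidOfRevolution_sq_unit :
    volume (solidOfRevolution (fun x => x ^ 2) 0 1) = ENNReal.ofReal (π / 5) := by
  rw [volume_solidOfRevolution_of_continuous (by fun_prop) zero_le_one]
  congr 1
  have : (fun x : ℝ => (x ^ 2) ^ 2) = fun x => x ^ 4 := by funext x; ring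
  rw [this, integral_pow]
  ring

/-! ### The washer method -/

/-- The washer solid obtained by revolving the region between the graphs of `f ≤ g` on `[a, b]` about the `x`
axis: `{(x, y, z) | a ≤ x ≤ b, (f x)² ≤ y² + z² ≤ (g x)²}`. [cite: MarsdenWeinstein1985, Sect. 9.1 p. 424] -/
def washerSolid (f g : ℝ → ℝ) (a b : ℝ) : Set (ℝ × (ℝ × ℝ)) :=
  {p | p.1 ∈ Icc a b ∧ f p.1 ^ 2 ≤ p.2.1 ^ 2 + p.2.2 ^ 2 ∧ p.2.1 ^ 2 + p.2.2 ^ 2 ≤ g p.1 ^ 2}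

/-- The washer solid of measurable profiles is measurable. [cite: MarsdenWeinstein1985, Sect. 9.1 p. 424] -/
theorem measurableSet_washerSolid {f g : ℝ → ℝ} (hf : Measurable f) (hg : Measurable g) (a b : ℝ) :
    MeasurableSet (washerSolid f g a b) :=
  (measurableSet_Icc.preimage measurable_fst).inter
    ((measurableSet_le ((hf.comp measurable_fst).pow_const 2) (by fun_prop)).inter
      (measurableSet_le (by fun_prop) ((hg.comp measurable_fst).pow_const 2)))

/-- The slice of the washer solid at `x ∈ [a, b]` is the annulus `{(f x)² ≤ y² + z² ≤ (g x)²}`, of area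
`π ((g x)² - (f x)²)` when `(f x)² ≤ (g x)²`. [cite: MarsdenWeinstein1985, Sect. 9.1 p. 424] -/
theorem volume_slice_washerSolid (f g : ℝ → ℝ) {a b x : ℝ} (hx : x ∈ Icc a b) (hfg : f x ^ 2 ≤ g x ^ 2) :
    volume (Prod.mk x ⁻¹' washerSolid f g a b) = ENNReal.ofReal (π * (g x ^ 2 - f x ^ 2)) := by
  have hset : Prod.mk x ⁻¹' washerSolid f g a b =
      {q : ℝ × ℝ | q.1 ^ 2 + q.2 ^ 2 ≤ g x ^ 2} \ {q : ℝ × ℝ | q.1 ^ 2 + q.2 ^ 2 < f x ^ 2} := by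
    ext q
    simp only [washerSolid, mem_preimage, mem_setOf_eq, hx, true_and, Set.mem_sdiff, not_lt]
    tauto
  have hsub : {q : ℝ × ℝ | q.1 ^ 2 + q.2 ^ 2 < f x ^ 2} ⊆ {q : ℝ × ℝ | q.1 ^ 2 + q.2 ^ 2 ≤ g x ^ 2} :=
    fun q hq => le_trans (le_of_lt hq) hfg
  have hmeas : MeasurableSet {q : ℝ × ℝ | q.1 ^ 2 + q.2 ^ 2 < f x ^ 2} :=
    measurableSet_lt (by fun_prop) measurable_const
  rw [hset, measure_sdiff hsub hmeas.nullMeasurableSet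
      (by rw [volume_openDisc (sq_nonneg _)]; exact ENNReal.ofReal_ne_top),
    volume_closedDisc (sq_nonneg _), volume_openDisc (sq_nonneg _), mul_sub,
    ENNReal.ofReal_sub _ (by positivity)]

/-- **Washer method** (Marsden–Weinstein Sect. 9.1, p. 424): revolving the region between the graphs of
`0 ≤ f ≤ g` on `[a, b]` about the `x` axis gives a solid of volume `π ∫ x in a..b, ((g x)² - (f x)²)`
(measurable profiles with `f²`, `g²` integrable on `[a, b]`). [cite: MarsdenWeinstein1985, Sect. 9.1 p. 424] -/
theorem volume_washerSolid {f g : ℝ → ℝ} (hf : Measurable f) (hg : Measurable g) {a b : ℝ} (hab : a ≤ b)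
    (hf0 : ∀ x ∈ Icc a b, 0 ≤ f x) (hfg : ∀ x ∈ Icc a b, f x ≤ g x)
    (hfi : IntervalIntegrable (fun x => f x ^ 2) volume a b)
    (hgi : IntervalIntegrable (fun x => g x ^ 2) volume a b) :
    volume (washerSolid f g a b) = ENNReal.ofReal (π * ∫ x in a..b, (g x ^ 2 - f x ^ 2)) := by
  have hsq : ∀ x ∈ Icc a b, f x ^ 2 ≤ g x ^ 2 := fun x hx => pow_le_pow_left₀ (hf0 x hx) (hfg x hx) 2
  rw [← intervalIntegral.integral_const_mul]
  exact volume_eq_integral_sliceArea (measurableSet_washerSolid hf hg a b) hab (fun p hp => hp.1)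
    (fun x hx => volume_slice_washerSolid f g hx (hsq x hx))
    (fun x hx => mul_nonneg pi_pos.le (sub_nonneg.mpr (hsq x hx))) ((hgi.sub hfi).const_mul π)

/-! ### The shell method -/

/-- The radial coordinate `|w| = √(w₁² + w₂²)` of the plane of rotation (the first component of Mathlib's
`polarCoord`). [cite: MarsdenWeinstein1985, Sect. 9.2 p. 428] -/
def planeRadius (w : ℝ × ℝ) : ℝ := √(w.1 ^ 2 + w.2 ^ 2)

/-- `planeRadius` is measurable. [cite: MarsdenWeinstein1985, Sect. 9.2 p. 428] -/
theorem measurable_planeRadius : Measurable planeRadius := by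
  unfold planeRadius; fun_prop

/-- In polar coordinates the radius is the first coordinate: `|(r cos θ, r sin θ)| = r` for `r > 0`.
[cite: MarsdenWeinstein1985, Sect. 9.2 p. 428] -/
theorem planeRadius_polarCoord_symm {p : ℝ × ℝ} (hp : p ∈ polarCoord.target) :
    planeRadius (polarCoord.symm p) = p.1 := by
  have hr : 0 < p.1 := (mem_prod.mp hp).1
  simp only [planeRadius, polarCoord_symm_apply]
  rw [show (p.1 * cos p.2) ^ 2 + (p.1 * sin p.2) ^ 2 = p.1 ^ 2 by nlinarith [sin_sq_add_cos_sq p.2],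
    sqrt_sq hr.le]

/-- The solid obtained by revolving the region between the graphs of `f ≤ g` on `[a, b]` (`0 ≤ a`) about the
vertical axis: `{(w, y) | a ≤ |w| ≤ b, f |w| ≤ y ≤ g |w|}`, `w ∈ ℝ × ℝ` the horizontal position, `y` the height.
[cite: MarsdenWeinstein1985, Sect. 9.2 p. 429] -/
def shellSolidBetween (f g : ℝ → ℝ) (a b : ℝ) : Set ((ℝ × ℝ) × ℝ) :=
  {p | planeRadius p.1 ∈ Icc a b ∧ f (planeRadius p.1) ≤ p.2 ∧ p.2 ≤ g (planeRadius p.1)}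

/-- The solid obtained by revolving the region under the graph of `f` on `[a, b]` about the vertical axis:
`{(w, y) | a ≤ |w| ≤ b, 0 ≤ y ≤ f |w|}`. [cite: MarsdenWeinstein1985, Sect. 9.2 p. 429] -/
def shellSolid (f : ℝ → ℝ) (a b : ℝ) : Set ((ℝ × ℝ) × ℝ) :=
  shellSolidBetween (fun _ => 0) f a b

/-- The shell solid of measurable profiles is measurable. [cite: MarsdenWeinstein1985, Sect. 9.2 p. 429] -/
theorem measurableSet_shellSolidBetween {f g : ℝ → ℝ} (hf : Measurable f) (hg : Measurable g) (a b : ℝ) :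
    MeasurableSet (shellSolidBetween f g a b) := by
  have hr : Measurable fun p : (ℝ × ℝ) × ℝ => planeRadius p.1 := measurable_planeRadius.comp measurable_fst
  exact (measurableSet_Icc.preimage hr).inter
    ((measurableSet_le (hf.comp hr) measurable_snd).inter (measurableSet_le measurable_snd (hg.comp hr)))

/-- The vertical fibre of the shell solid over the horizontal point `w` is the segment `[f |w|, g |w|]` if
`a ≤ |w| ≤ b` and empty otherwise; its length is `g |w| - f |w|`. [cite: MarsdenWeinstein1985, Sect. 9.2 p. 430] -/
theorem volume_fibre_shellSolidBetween (f g : ℝ → ℝ) (a b : ℝ) (w : ℝ × ℝ) :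
    volume (Prod.mk w ⁻¹' shellSolidBetween f g a b) =
      (Icc a b).indicator (fun r => ENNReal.ofReal (g r - f r)) (planeRadius w) := by
  by_cases hw : planeRadius w ∈ Icc a b
  · rw [indicator_of_mem hw]
    have : Prod.mk w ⁻¹' shellSolidBetween f g a b = Icc (f (planeRadius w)) (g (planeRadius w)) := by
      ext y
      simp [shellSolidBetween, mem_Icc.mp hw]
    rw [this, Real.volume_Icc]
  · rw [indicator_of_notMem hw]
    have : Prod.mk w ⁻¹' shellSolidBetween f g a b = ∅ :=
      eq_empty_of_forall_notMem fun y hy => hw hy.1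
    rw [this, measure_empty]

/-- **Shell method, measure form** (Marsden–Weinstein Sect. 9.2, justification pp. 430–431): for measurable profiles
and `0 ≤ a`, the volume of the shell solid is the polar-coordinate integral
`2 π ∫⁻ r in Ioc a b, r (g r - f r)` (extended-real valued; no integrability or sign hypothesis).
[cite: MarsdenWeinstein1985, Sect. 9.2 pp. 429-431] -/
theorem volume_shellSolidBetween_eq_lintegral {f g : ℝ → ℝ} (hf : Measurable f) (hg : Measurable g) {a b : ℝ}
    (ha : 0 ≤ a) :
    volume (shellSolidBetween f g a b) =
      ENNReal.ofReal (2 * π) * ∫⁻ r in Ioc a b, ENNReal.ofReal (r * (g r - f r)) := by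
  have hS := measurableSet_shellSolidBetween hf hg a b
  rw [Measure.volume_eq_prod, Measure.prod_apply hS]
  simp_rw [volume_fibre_shellSolidBetween]
  -- the horizontal integral of the radial function, in polar coordinates
  set φ : ℝ → ℝ≥0∞ := (Icc a b).indicator fun r => ENNReal.ofReal (g r - f r) with hφ
  have hφm : Measurable φ := (Measurable.ennreal_ofReal (hg.sub hf)).indicator measurableSet_Icc
  have hpol := lintegral_comp_polarCoord_symm (fun w : ℝ × ℝ => φ (planeRadius w))
  beta_reduce at hpol
  rw [← hpol]
  have hcongr : ∫⁻ p in polarCoord.target, ENNReal.ofReal p.1 • φ (planeRadius (polarCoord.symm p)) =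
      ∫⁻ p in polarCoord.target, ENNReal.ofReal p.1 * φ p.1 := by
    refine setLIntegral_congr_fun polarCoord.open_target.measurableSet fun p hp => ?_
    simp only [smul_eq_mul, planeRadius_polarCoord_symm hp]
  have hmeas : Measurable fun p : ℝ × ℝ => ENNReal.ofReal p.1 * φ p.1 :=
    (Measurable.ennreal_ofReal measurable_fst).mul (hφm.comp measurable_fst)
  rw [hcongr, polarCoord_target, Measure.volume_eq_prod, setLIntegral_prod _ hmeas.aemeasurable]
  simp only [lintegral_const, Measure.restrict_apply_univ, Real.volume_Ioo]
  rw [show π - -π = 2 * π by ring]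
  -- `∫⁻ r in Ioi 0, ofReal r * φ r * ofReal (2π) = ofReal (2π) * ∫⁻ r in Ioc a b, ofReal (r (g r - f r))`
  have hIoi : ∫⁻ r in Ioi (0 : ℝ), ENNReal.ofReal r * φ r * ENNReal.ofReal (2 * π) =
      ENNReal.ofReal (2 * π) * ∫⁻ r in Ioi (0 : ℝ), (Icc a b).indicator
        (fun r => ENNReal.ofReal (r * (g r - f r))) r := by
    rw [← lintegral_const_mul _ ((Measurable.ennreal_ofReal (by fun_prop)).indicator measurableSet_Icc)]
    refine setLIntegral_congr_fun measurableSet_Ioi fun r hr => ?_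
    by_cases hrI : r ∈ Icc a b
    · simp only [hφ, indicator_of_mem hrI]
      rw [ENNReal.ofReal_mul (le_of_lt hr)]
      ring
    · simp only [hφ, indicator_of_notMem hrI, mul_zero, zero_mul]
  rw [hIoi]
  congr 1
  rw [lintegral_indicator measurableSet_Icc, Measure.restrict_restrict measurableSet_Icc]
  rcases ha.eq_or_lt with rfl | ha'
  · rw [show Icc (0 : ℝ) b ∩ Ioi 0 = Ioc 0 b from by
      ext r
      simp only [mem_inter_iff, mem_Icc, mem_Ioi, mem_Ioc]
      constructor
      · rintro ⟨⟨-, h2⟩, h3⟩; exact ⟨h3, h2⟩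
      · rintro ⟨h1, h2⟩; exact ⟨⟨h1.le, h2⟩, h1⟩]
  · rw [show Icc a b ∩ Ioi 0 = Icc a b from by
      ext r
      simp only [mem_inter_iff, mem_Icc, mem_Ioi]
      constructor
      · rintro ⟨h, -⟩; exact h
      · intro h; exact ⟨h, ha'.trans_le h.1⟩]
    exact setLIntegral_congr Ioc_ae_eq_Icc.symm

/-- **Shell method** (Marsden–Weinstein Sect. 9.2, box p. 429, second formula): revolving the region between the
graphs of `f ≤ g` on `[a, b]` (`0 ≤ a ≤ b`) about the vertical axis gives a solid of volume
`2 π ∫ x in a..b, x (g x - f x)` (measurable profiles, `x (g x - f x)` integrable on `[a, b]`).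
[cite: MarsdenWeinstein1985, Sect. 9.2 p. 429] -/
theorem volume_shellSolidBetween {f g : ℝ → ℝ} (hf : Measurable f) (hg : Measurable g) {a b : ℝ} (ha : 0 ≤ a)
    (hab : a ≤ b) (hfg : ∀ x ∈ Icc a b, f x ≤ g x)
    (hi : IntervalIntegrable (fun x => x * (g x - f x)) volume a b) :
    volume (shellSolidBetween f g a b) = ENNReal.ofReal (2 * π * ∫ x in a..b, x * (g x - f x)) := by
  have hi' : IntegrableOn (fun x => x * (g x - f x)) (Ioc a b) :=
    (intervalIntegrable_iff_integrableOn_Ioc_of_le hab).mp hi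
  have hnn : 0 ≤ᵐ[volume.restrict (Ioc a b)] fun x => x * (g x - f x) :=
    (ae_restrict_iff' measurableSet_Ioc).mpr (Eventually.of_forall fun x hx =>
      mul_nonneg (ha.trans hx.1.le) (sub_nonneg.mpr (hfg x (Ioc_subset_Icc_self hx))))
  rw [volume_shellSolidBetween_eq_lintegral hf hg ha, intervalIntegral.integral_of_le hab,
    ← ofReal_integral_eq_lintegral_ofReal hi' hnn, ← ENNReal.ofReal_mul (by positivity)]

/-- **Shell method** (Marsden–Weinstein Sect. 9.2, box p. 429): revolving the region under the graph of a
non-negative `f` on `[a, b]` (`0 ≤ a ≤ b`) about the vertical axis gives a solid of volume `2 π ∫ x in a..b, x f x`.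
[cite: MarsdenWeinstein1985, Sect. 9.2 p. 429] -/
theorem volume_shellSolid {f : ℝ → ℝ} (hf : Measurable f) {a b : ℝ} (ha : 0 ≤ a) (hab : a ≤ b)
    (hf0 : ∀ x ∈ Icc a b, 0 ≤ f x) (hi : IntervalIntegrable (fun x => x * f x) volume a b) :
    volume (shellSolid f a b) = ENNReal.ofReal (2 * π * ∫ x in a..b, x * f x) := by
  have h := volume_shellSolidBetween measurable_const hf ha hab hf0 (by simpa using hi)
  simpa [shellSolid] using h

/-- Shell method for a continuous non-negative profile. [cite: MarsdenWeinstein1985, Sect. 9.2 p. 429] -/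
theorem volume_shellSolid_of_continuous {f : ℝ → ℝ} (hf : Continuous f) {a b : ℝ} (ha : 0 ≤ a) (hab : a ≤ b)
    (hf0 : ∀ x ∈ Icc a b, 0 ≤ f x) :
    volume (shellSolid f a b) = ENNReal.ofReal (2 * π * ∫ x in a..b, x * f x) :=
  volume_shellSolid hf.measurable ha hab hf0 ((continuous_id.mul hf).intervalIntegrable a b)

/-- Marsden–Weinstein Sect. 9.2 Example 1: revolving the region under `x²` on `[0, 1]` about the `y` axis gives the
"bowl" of volume `2 π ∫₀¹ x³ dx = π / 2`. [cite: MarsdenWeinstein1985, Sect. 9.2 Example 1] -/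
theorem volume_shellSolid_sq_unit :
    volume (shellSolid (fun x => x ^ 2) 0 1) = ENNReal.ofReal (π / 2) := by
  rw [volume_shellSolid_of_continuous (by fun_prop) le_rfl zero_le_one (fun x _ => by positivity)]
  congr 1
  have : (fun x : ℝ => x * x ^ 2) = fun x => x ^ 3 := by funext x; ring
  rw [this, integral_pow]
  ring

/-! ### The ball as a solid of revolution -/

/-- The closed ball `x² + y² + z² ≤ R²` is the solid of revolution of the half-disc profile `√(R² - x²)` on
`[-R, R]`. [cite: MarsdenWeinstein1985, Sect. 9.2 p. 430] -/
theorem solidOfRevolution_sqrt_eq_ball {R : ℝ} (hR : 0 ≤ R) :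
    solidOfRevolution (fun x => √(R ^ 2 - x ^ 2)) (-R) R =
      {p : ℝ × (ℝ × ℝ) | p.1 ^ 2 + p.2.1 ^ 2 + p.2.2 ^ 2 ≤ R ^ 2} := by
  ext p
  simp only [solidOfRevolution, mem_setOf_eq, mem_Icc]
  constructor
  · rintro ⟨⟨h1, h2⟩, h3⟩
    rw [sq_sqrt (by nlinarith)] at h3
    linarith
  · intro h
    have hx : p.1 ^ 2 ≤ R ^ 2 := by nlinarith [sq_nonneg p.2.1, sq_nonneg p.2.2]
    refine ⟨abs_le_of_sq_le_sq' hx hR, ?_⟩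
    rw [sq_sqrt (by nlinarith)]
    linarith

/-- The volume of the ball of radius `R` recovered by the disk method: `π ∫ x in -R..R, (R² - x²) = 4 π R³ / 3`
(Marsden–Weinstein Sect. 9.2 p. 430: "we then recover the formula for the volume of the ball").
[cite: MarsdenWeinstein1985, Sect. 9.2 p. 430] -/
theorem volume_ball_three_diskMethod {R : ℝ} (hR : 0 ≤ R) :
    volume {p : ℝ × (ℝ × ℝ) | p.1 ^ 2 + p.2.1 ^ 2 + p.2.2 ^ 2 ≤ R ^ 2} =
      ENNReal.ofReal (4 / 3 * π * R ^ 3) := by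
  rw [← solidOfRevolution_sqrt_eq_ball hR,
    volume_solidOfRevolution_of_continuous (by fun_prop) (by linarith : -R ≤ R)]
  congr 1
  have h : ∫ x in (-R)..R, √(R ^ 2 - x ^ 2) ^ 2 = ∫ x in (-R)..R, (R ^ 2 - x ^ 2) := by
    refine intervalIntegral.integral_congr fun x hx => ?_
    rw [uIcc_of_le (by linarith), mem_Icc] at hx
    exact sq_sqrt (by nlinarith)
  rw [h, intervalIntegral.integral_sub (by apply Continuous.intervalIntegrable; fun_prop)
      (by apply Continuous.intervalIntegrable; fun_prop), intervalIntegral.integral_const, integral_pow]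
  simp only [smul_eq_mul]
  ring

end

end Literature.MeasureTheory.Integral
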